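import Summits.QuantumFields.BalabanUV.T4Continuum.Spine.NE3.AxialGaugeDivergence
import Summits.QuantumFields.BalabanUV.T4Continuum.Support.NE3NestedBlockMeanCovariance
import Summits.QuantumFields.BalabanUV.T4Continuum.Support.NE3DressedBlockField
import Summits.QuantumFields.BalabanUV.T4Continuum.Support.NE3SquaredTentBump
import HarnessLib

/-!
# NE7SquaredBumpCovariantLaplacian — THE `C¹` GAIN AT A CURVED BACKGROUND: the COVARIANT site Laplacian of the dressed squared-tent bump `dressW M W (bump2 M c)` is
# `O(1∕M²)·‖c‖_∞` EVERYWHERE (file 116 of the curved (APE), F186; third brick of (T1♯))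

Cell `pub-balaban`, rung (B)+1 sub-cell t4, lineage `b2b-balaban-t4-ne7-p1` (CRUX PROVER NE7 #1 = OWNER of row NE7), generation 84; memo `t4/b2b-balaban-t4-ne7-p1-g84/SCALAR-ROWS.md` §3.
Over row NE3's census R37–R39 kinematics BY NAME: `SupRegularityLocalGauge.covLapSite_eq_neg_flat_sub_transport` ∕ `norm_transport_pair_sub_comm_le` ∕ `norm_comm_le`,
`SlicePoincareSlicB8Gauge.covLapSite_gaugeAct`, `NE3NestedBlockMeanCovariance.comb_nearOne` (comb box radius `a = (d−1)(M−1)x`), `AxialGaugeDivergence.norm_axialDivergence_le`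
(comb divergence `δ = 2d²(M−1)x₁ + 8d³(M−1)²x²` from the plaquette-gradient radius `x₁`), `NE3SquaredTentProfile.abs_tentSq_sdiff_le ∕ abs_tentSq_step_le` (the flat `C¹` profile).
WHY.  (T1♯) (F182∕F183) asks for an exact right inverse of `bmeanIterW` with COVARIANT-LAPLACIAN sup `C_a′ ≍ 1∕M²`; F185's `sfixW θ′ = dressW M W (bump2 M (sfixCoef θ′))` is exact
with sup `≤ 2·64^d‖θ′‖_∞`; THIS FILE bounds the covariant Laplacian of ANY dressed squared bump by `K_Δ·sup‖c‖`,
`K_Δ = 35d∕M² + 2δ + 4d·a² + 8d·a∕M = O((1 + d²b + d²M³x₁ + d³b²)∕M²)` (`b = M²x`).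
WHAT ([folklore]; 0 def, 0 sorry).  §1 bookkeeping (`fac ≤ 2∕M` near a face and its propagation to the `2d` neighbours; interior block coordinates); §2 the crude bound
`‖Δ_W v(y)‖ ≤ 8d·B` and the near-face bound `32d∕M²·sup‖c‖`; §3 **`norm_covLapSite_dressW_bump2_interior_le`** (comb gauge of the block: `(3d∕M² + 2δ + 4da² + 8da∕M)·‖c z‖`);
§4 **`norm_covLapSite_dressW_bump2_le`** (every site).
HONEST FRAMING (page 1): lattice kinematics at one unitary background with small plaquettes and small covariant plaquette gradients; nothing of Bałaban's asserted; (T1♯)'s assembly,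
(APE) on curved data NOT proved here; NOT ONE-STEP, NOT NE7; spine 0∕9; finite T⁴ rung (B)+1 — NOT infinite volume, NOT mass gap, NOT `BetaPertH`, NOT Clay.  Continuum YM on T⁴ ⇐
BetaPertH ∧ nine spine estimates (0/9 proved); BetaPertH ⇐ (D1) ∧ (D4) ∧ CAP+tail; G-an2-4 gates asym, D1 and NE2/3/4.
-/
set_option autoImplicit false

open scoped BigOperators Matrix Matrix.Norms.L2Operator
open NormedSpace Finset

namespace Summit.QuantumFields.BalabanUV.T4Continuum.NE7SquaredBumpCovariantLaplacian

open Literature.MathematicalPhysics.QuantumFieldTheory.Balaban1983to89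
open B7Prop1Explicit B7Prop2Explicit
open T4AveragingDeficitWall (Ad IsUnitaryCfg SmallField)
open AveragingDeficitTransport (norm_Ad_of_unitary)
open AveragingDeficitNearIdentity (Ad_real_smul)
open AveragingDeficitBlockDensity (btree btree_mem btree_eq_axialFn)
open SmoothRefineBlocks (blk res res_nonneg res_lt res_le blk_add_res blk_add_e res_add_e_self res_add_e_ne)
open NE3TentBump (fac fac_nonneg fac_le_one wt_eq tent tent_nonneg tent_le_one)
open NE3SquaredTentProfile (res_blk_sub_e_of_res_eq_zero res_blk_sub_e_of_res_ne_zero res_sub_e_ne abs_tentSq_step_le abs_tentSq_sdiff_le tent_eq_fac_mul)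
open NE3SquaredTentBump (bump2)
open NE3DressedBlockField (dressW)
open NE3CombGauge (isUnitaryCfg_comb)
open NE3NestedBlockMeanCovariance (comb_nearOne)
open NE3GaugeDirFrames (Ad_Ad_inv)
open NE3.PairLandauB8 (covLapSite)
open NE3.SupRegularityLocalGauge (covLapSite_eq_neg_flat_sub_transport norm_transport_pair_sub_comm_le norm_comm_le)
open NE3.SlicePoincareSlicB8Gauge (covLapSite_gaugeAct)
open NE3.AxialGaugeDivergence (norm_axialDivergence_le)

noncomputable section

variable {d : ℕ} {n : Type*} [Fintype n] [DecidableEq n]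

/-! ## §1 Lattice bookkeeping -/

omit [Fintype n] [DecidableEq n] in
/-- Near a face (`ρ_i ≤ 1` or `ρ_i ≥ M − 2`) the own-direction factor is at most `2∕M`. [folklore] -/
theorem fac_le_two_div {M : ℕ} (hM : 1 ≤ M) {y : Site d} {i : Fin d} (h : res M y i ≤ 1 ∨ (M : ℤ) - 2 ≤ res M y i) :
    fac M y i ≤ 2 / (M : ℝ) := by
  have hM0 : (0 : ℝ) < M := by exact_mod_cast (by omega : 0 < M)
  have hr0 : (0 : ℝ) ≤ (res M y i : ℝ) := by exact_mod_cast res_nonneg hM y i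
  have hrM : (res M y i : ℝ) ≤ (M : ℝ) - 1 := by
    have := res_le hM y i
    have h' : ((res M y i : ℤ) : ℝ) ≤ (((M : ℤ) - 1 : ℤ) : ℝ) := by exact_mod_cast this
    push_cast at h'; exact h'
  unfold fac
  rw [wt_eq]
  set t : ℝ := (res M y i : ℝ) / M with ht
  have ht0 : 0 ≤ t := div_nonneg hr0 hM0.le
  have ht1 : t ≤ 1 := by rw [ht, div_le_one hM0]; linarith
  rcases h with h | h
  · have h' : (res M y i : ℝ) ≤ 1 := by exact_mod_cast h
    have htle : t ≤ 1 / M := by rw [ht]; exact div_le_div_of_nonneg_right h' hM0.le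
    calc t * (1 - t) ≤ (1 / M) * 1 := mul_le_mul htle (by linarith) (by linarith) (by positivity)
      _ ≤ 2 / M := by rw [mul_one]; exact div_le_div_of_nonneg_right (by norm_num) hM0.le
  · have h' : (M : ℝ) - 2 ≤ (res M y i : ℝ) := by
      have h'' : (((M : ℤ) - 2 : ℤ) : ℝ) ≤ ((res M y i : ℤ) : ℝ) := by exact_mod_cast h
      push_cast at h''; exact h''
    have h1t : 1 - t ≤ 2 / M := by
      rw [ht, sub_le_iff_le_add, ← sub_le_iff_le_add', le_div_iff₀ hM0]
      have : (1 - 2 / (M : ℝ)) * M = M - 2 := by field_simp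
      rw [this]; exact h'
    calc t * (1 - t) ≤ 1 * (2 / M) := mul_le_mul ht1 h1t (by linarith) (by norm_num)
      _ = 2 / M := one_mul _

omit [Fintype n] [DecidableEq n] in
/-- Near a face the tent is at most `2∕M` (the other factors are in `[0, 1]`). [folklore] -/
theorem tent_le_two_div {M : ℕ} (hM : 1 ≤ M) {y : Site d} {i : Fin d} (h : res M y i ≤ 1 ∨ (M : ℤ) - 2 ≤ res M y i) :
    tent M y ≤ 2 / (M : ℝ) := by
  rw [tent_eq_fac_mul M y i]
  have hP0 : 0 ≤ ∏ k ∈ Finset.univ.erase i, fac M y k := Finset.prod_nonneg fun k _ => fac_nonneg hM y k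
  have hP1 : ∏ k ∈ Finset.univ.erase i, fac M y k ≤ 1 := Finset.prod_le_one (fun k _ => fac_nonneg hM y k) fun k _ => fac_le_one hM y k
  have hM0 : (0 : ℝ) < M := by exact_mod_cast (by omega : 0 < M)
  calc fac M y i * ∏ k ∈ Finset.univ.erase i, fac M y k ≤ (2 / (M : ℝ)) * 1 :=
      mul_le_mul (fac_le_two_div hM h) hP1 hP0 (by positivity)
    _ = 2 / M := mul_one _

omit [Fintype n] [DecidableEq n] in
/-- The squared tent near a face: `tent² ≤ 4∕M²`. [folklore] -/
theorem tentSq_le_four_div {M : ℕ} (hM : 1 ≤ M) {y : Site d} {i : Fin d} (h : res M y i ≤ 1 ∨ (M : ℤ) - 2 ≤ res M y i) :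
    tent M y ^ 2 ≤ 4 / (M : ℝ) ^ 2 := by
  have h1 := tent_le_two_div hM h
  calc tent M y ^ 2 ≤ (2 / (M : ℝ)) ^ 2 := pow_le_pow_left₀ (tent_nonneg hM y) h1 2
    _ = 4 / (M : ℝ) ^ 2 := by rw [div_pow]; norm_num

omit [Fintype n] [DecidableEq n] in
/-- **NEAR-FACE PROPAGATION** (`M ≥ 2`): if `ρ_i(y) ∈ {0, M − 1}` then `y` and all its neighbours `y ± e_ν` are near the face in direction `i`. [folklore] -/
theorem nearFace_neighbours {M : ℕ} (hM : 2 ≤ M) {y : Site d} {i : Fin d} (h : res M y i = 0 ∨ res M y i = (M : ℤ) - 1) (ν : Fin d) :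
    (res M y i ≤ 1 ∨ (M : ℤ) - 2 ≤ res M y i) ∧
      (res M (y + e ν) i ≤ 1 ∨ (M : ℤ) - 2 ≤ res M (y + e ν) i) ∧
      (res M (y - e ν) i ≤ 1 ∨ (M : ℤ) - 2 ≤ res M (y - e ν) i) := by
  have hM1 : 1 ≤ M := by omega
  refine ⟨by rcases h with h | h <;> [left; right] <;> omega, ?_, ?_⟩
  · by_cases hν : i = ν
    · subst hν
      rw [res_add_e_self hM1]
      rcases h with h | h
      · rw [if_neg (by rw [h]; omega), h]; left; norm_num
      · rw [if_pos h]; left; norm_num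
    · rw [res_add_e_ne hM1 y hν]; rcases h with h | h <;> [left; right] <;> omega
  · by_cases hν : i = ν
    · subst hν
      rcases h with h | h
      · rw [(res_blk_sub_e_of_res_eq_zero hM1 h).1]; right; omega
      · have hne : res M y i ≠ 0 := by rw [h]; omega
        rw [(res_blk_sub_e_of_res_ne_zero hM1 hne).1, h]; right; omega
    · rw [res_sub_e_ne hM1 y hν]; rcases h with h | h <;> [left; right] <;> omega

omit [Fintype n] [DecidableEq n] in
/-- **INTERIOR BLOCK COORDINATES**: if no offset coordinate of `y` is `0` or `M − 1`, then `y`, `y + e_ν`, `y − e_ν` lie in the block of `z = blk M y` with offsets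
`ρ`, `ρ + e_ν`, `ρ − e_ν` in `[0, M)^d`, `ρ_ν ≠ M − 1`, `(ρ − e_ν)_ν = ρ_ν − 1 ∉ {M − 1}`, `ρ_ν ≠ 0`. [folklore] -/
theorem interior_coords {M : ℕ} (hM : 1 ≤ M) {y : Site d} (h : ∀ i, res M y i ≠ 0 ∧ res M y i ≠ (M : ℤ) - 1) (ν : Fin d) :
    blk M (y + e ν) = blk M y ∧ blk M (y - e ν) = blk M y ∧
      res M (y + e ν) = res M y + e ν ∧ res M (y - e ν) = res M y - e ν := by
  have hb := blk_add_e hM y ν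
  rw [if_neg (h ν).2, add_zero] at hb
  obtain ⟨hrm, hbm⟩ := res_blk_sub_e_of_res_ne_zero hM (h ν).1
  refine ⟨hb, hbm, ?_, ?_⟩
  · ext i
    by_cases hi : i = ν
    · subst hi; rw [res_add_e_self hM, if_neg (h i).2, Pi.add_apply, e_apply, if_pos rfl]
    · rw [res_add_e_ne hM y hi, Pi.add_apply, e_apply, if_neg hi, add_zero]
  · ext i
    by_cases hi : i = ν
    · subst hi; rw [hrm, Pi.sub_apply, e_apply, if_pos rfl]
    · rw [res_sub_e_ne hM y hi, Pi.sub_apply, e_apply, if_neg hi, sub_zero]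

/-! ## §2 The crude bound on the covariant site Laplacian -/

/-- **CRUDE BOUND**: at a unitary background, `‖Δ_W v(y)‖ ≤ 8d·B` whenever `‖v‖ ≤ B` at `y` and at its `2d` neighbours. [folklore] -/
theorem norm_covLapSite_le_crude [Nonempty n] {W : Site d → Fin d → (Matrix n n ℂ)ˣ} (hWu : IsUnitaryCfg W) (v : Site d → Matrix n n ℂ) (y : Site d)
    {B : ℝ} (hy : ‖v y‖ ≤ B) (hp : ∀ ν : Fin d, ‖v (y + e ν)‖ ≤ B) (hm : ∀ ν : Fin d, ‖v (y - e ν)‖ ≤ B) :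
    ‖covLapSite W v y‖ ≤ 8 * (d : ℝ) * B := by
  rw [covLapSite_eq_neg_flat_sub_transport W v y]
  have h1 : ‖∑ ν : Fin d, ((v (y + e ν) - v y) - (v y - v (y - e ν)))‖ ≤ ∑ _ν : Fin d, (4 * B) := by
    refine (norm_sum_le _ _).trans (Finset.sum_le_sum fun ν _ => ?_)
    calc ‖(v (y + e ν) - v y) - (v y - v (y - e ν))‖ ≤ ‖v (y + e ν) - v y‖ + ‖v y - v (y - e ν)‖ := norm_sub_le _ _
      _ ≤ (‖v (y + e ν)‖ + ‖v y‖) + (‖v y‖ + ‖v (y - e ν)‖) := add_le_add (norm_sub_le _ _) (norm_sub_le _ _)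
      _ ≤ (B + B) + (B + B) := by gcongr <;> first | exact hp ν | exact hy | exact hm ν
      _ = 4 * B := by ring
  have h2 : ‖∑ ν : Fin d, ((Ad (W y ν) (v (y + e ν)) - v (y + e ν)) + (Ad (W (y - e ν) ν)⁻¹ (v (y - e ν)) - v (y - e ν)))‖
      ≤ ∑ _ν : Fin d, (4 * B) := by
    refine (norm_sum_le _ _).trans (Finset.sum_le_sum fun ν _ => ?_)
    have hu1 : ‖Ad (W y ν) (v (y + e ν))‖ = ‖v (y + e ν)‖ := norm_Ad_of_unitary (hWu y ν) _
    have hu2 : ‖Ad (W (y - e ν) ν)⁻¹ (v (y - e ν))‖ = ‖v (y - e ν)‖ := norm_Ad_of_unitary ((unitaryUnits _).inv_mem (hWu _ ν)) _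
    calc ‖(Ad (W y ν) (v (y + e ν)) - v (y + e ν)) + (Ad (W (y - e ν) ν)⁻¹ (v (y - e ν)) - v (y - e ν))‖
        ≤ ‖Ad (W y ν) (v (y + e ν)) - v (y + e ν)‖ + ‖Ad (W (y - e ν) ν)⁻¹ (v (y - e ν)) - v (y - e ν)‖ := norm_add_le _ _
      _ ≤ (‖Ad (W y ν) (v (y + e ν))‖ + ‖v (y + e ν)‖) + (‖Ad (W (y - e ν) ν)⁻¹ (v (y - e ν))‖ + ‖v (y - e ν)‖) :=
          add_le_add (norm_sub_le _ _) (norm_sub_le _ _)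
      _ ≤ (B + B) + (B + B) := by rw [hu1, hu2]; gcongr <;> first | exact hp ν | exact hm ν
      _ = 4 * B := by ring
  rw [Finset.sum_const, Finset.card_univ, Fintype.card_fin, nsmul_eq_mul] at h1 h2
  calc _ ≤ ‖-(∑ ν : Fin d, ((v (y + e ν) - v y) - (v y - v (y - e ν))))‖
          + ‖∑ ν : Fin d, ((Ad (W y ν) (v (y + e ν)) - v (y + e ν)) + (Ad (W (y - e ν) ν)⁻¹ (v (y - e ν)) - v (y - e ν)))‖ := norm_sub_le _ _
    _ ≤ (d : ℝ) * (4 * B) + (d : ℝ) * (4 * B) := by rw [norm_neg]; exact add_le_add h1 h2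
    _ = 8 * (d : ℝ) * B := by ring

/-- **THE NEAR-FACE BOUND FOR THE DRESSED SQUARED BUMP** (`M ≥ 2`, `W` unitary): if some `ρ_i(y) ∈ {0, M − 1}` then
`‖Δ_W (dressW M W (bump2 M c)) y‖ ≤ 32d∕M² · sup‖c‖`. [folklore] -/
theorem norm_covLapSite_dressW_bump2_nearFace_le [Nonempty n] {M : ℕ} (hM : 2 ≤ M) {W : Site d → Fin d → (Matrix n n ℂ)ˣ} (hWu : IsUnitaryCfg W)
    (c : Site d → Matrix n n ℂ) {C : ℝ} (hc : ∀ z, ‖c z‖ ≤ C) {y : Site d} {i : Fin d} (h : res M y i = 0 ∨ res M y i = (M : ℤ) - 1) :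
    ‖covLapSite W (dressW M W (bump2 M c)) y‖ ≤ 32 * (d : ℝ) / (M : ℝ) ^ 2 * C := by
  have hM1 : 1 ≤ M := by omega
  have hC0 : 0 ≤ C := (norm_nonneg _).trans (hc 0)
  have hval : ∀ x : Site d, (res M x i ≤ 1 ∨ (M : ℤ) - 2 ≤ res M x i) → ‖dressW M W (bump2 M c) x‖ ≤ 4 / (M : ℝ) ^ 2 * C := by
    intro x hx
    unfold dressW bump2
    rw [Ad_real_smul, norm_smul, Real.norm_of_nonneg (sq_nonneg _), norm_Ad_of_unitary ((unitaryUnits _).inv_mem (btree_mem hWu M _ _))]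
    exact mul_le_mul (tentSq_le_four_div hM1 hx) (hc _) (norm_nonneg _) (by positivity)
  have hB := fun ν => nearFace_neighbours hM h ν
  refine (norm_covLapSite_le_crude hWu _ y (hval y (hB ⟨0, by
    rcases d with _ | d
    · exact (Fin.elim0 i)
    · exact Nat.succ_pos _⟩).1) (fun ν => hval _ (hB ν).2.1) (fun ν => hval _ (hB ν).2.2)).trans (le_of_eq ?_)
  ring

/-! ## §3 The interior bound in the comb gauge of the block -/

/-- **THE INTERIOR BOUND** (`M ≥ 2`, `W` unitary with `SmallField W x` and covariant plaquette gradients `≤ x₁`): if no offset coordinate of `y` is `0` or `M − 1`, then with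
`a = (d−1)(M−1)x` (the comb box radius) and `δ = 2d²(M−1)x₁ + 8d³(M−1)²x²` (the comb divergence),
`‖Δ_W (dressW M W (bump2 M c)) y‖ ≤ (3d∕M² + 2δ + 4d·a² + 8d·a∕M)·‖c (blk M y)‖`. [folklore] -/
theorem norm_covLapSite_dressW_bump2_interior_le [Nonempty n] {M : ℕ} (hM : 2 ≤ M) {W : Site d → Fin d → (Matrix n n ℂ)ˣ} (hWu : IsUnitaryCfg W)
    {x x₁ : ℝ} (hx : 0 ≤ x) (hx10 : 0 ≤ x₁) (hWx : SmallField W x)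
    (hgrad : ∀ (p : Site d) (μ κ : Fin d), κ ≠ μ →
      ‖Ad (W p μ) ((hol W (p + e μ) (plaqWord κ μ) : (Matrix n n ℂ)ˣ) : Matrix n n ℂ) - ((hol W p (plaqWord κ μ) : (Matrix n n ℂ)ˣ) : Matrix n n ℂ)‖ ≤ x₁)
    (c : Site d → Matrix n n ℂ) {y : Site d} (h : ∀ i, res M y i ≠ 0 ∧ res M y i ≠ (M : ℤ) - 1) :
    ‖covLapSite W (dressW M W (bump2 M c)) y‖
      ≤ (3 * (d : ℝ) / (M : ℝ) ^ 2 + 2 * (2 * (d : ℝ) ^ 2 * ((M : ℝ) - 1) * x₁ + 8 * (d : ℝ) ^ 3 * ((M : ℝ) - 1) ^ 2 * x ^ 2)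
          + 4 * (d : ℝ) * (((d : ℝ) - 1) * ((M : ℝ) - 1) * x) ^ 2 + 8 * (d : ℝ) * (((d : ℝ) - 1) * ((M : ℝ) - 1) * x) / M) * ‖c (blk M y)‖ := by
  have hM1 : 1 ≤ M := by omega
  have hM0 : (0 : ℝ) < M := by exact_mod_cast (by omega : 0 < M)
  set z : Site d := blk M y with hz
  set ρ : Site d := res M y with hρ
  set X : Matrix n n ℂ := c z with hX
  set u : Site d → (Matrix n n ℂ)ˣ := btree M W z with hu
  set F : Site d → Matrix n n ℂ := dressW M W (bump2 M c) with hF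
  have hyz : (M : ℤ) • z + ρ = y := blk_add_res M y
  have hyi : ∀ i, y i = (M : ℤ) * z i + ρ i := fun i => by
    have := congrFun hyz i
    simp only [Pi.add_apply, Pi.smul_apply, smul_eq_mul] at this
    exact this.symm
  have hρ0 : ∀ i, 0 ≤ ρ i := fun i => res_nonneg hM1 y i
  have hρM : ∀ i, ρ i ≤ (M : ℤ) - 1 := fun i => res_le hM1 y i
  have hρlo : ∀ i, 1 ≤ ρ i := fun i => by have := hρ0 i; have := (h i).1; omega
  have hρhi : ∀ i, ρ i ≤ (M : ℤ) - 2 := fun i => by have := hρM i; have := (h i).2; omega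
  -- the values of `F` on the block of `z`
  have hval : ∀ x' : Site d, blk M x' = z → F x' = Ad (u x')⁻¹ (tent M x' ^ 2 • X) := by
    intro x' hx'
    simp only [hF, dressW, bump2, hX, hu]
    rw [show SkeletonLattice.cdiv M x' = blk M x' from rfl, hx']
  -- the gauged field `G = Ad_u F` is the flat squared bump `tent² • X` at `y` and at its neighbours
  set G : Site d → Matrix n n ℂ := fun x' => Ad (u x') (F x') with hG
  have hGval : ∀ x' : Site d, blk M x' = z → G x' = tent M x' ^ 2 • X := by
    intro x' hx'; simp only [hG]; rw [hval x' hx', Ad_Ad_inv]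
  have hGy : G y = tent M y ^ 2 • X := hGval y rfl
  have hGp : ∀ ν, G (y + e ν) = tent M (y + e ν) ^ 2 • X := fun ν => hGval _ (interior_coords hM1 h ν).1
  have hGm : ∀ ν, G (y - e ν) = tent M (y - e ν) ^ 2 • X := fun ν => hGval _ (interior_coords hM1 h ν).2.1
  -- gauge covariance of the covariant site Laplacian
  set W' : Site d → Fin d → (Matrix n n ℂ)ˣ := gaugeAct u W with hW'
  have hW'u : IsUnitaryCfg W' := isUnitaryCfg_comb hWu M z
  have hcov : ‖covLapSite W F y‖ = ‖covLapSite W' G y‖ := by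
    have h1 := congrFun (covLapSite_gaugeAct u W F) y
    rw [show covLapSite W' G y = Ad (u y) (covLapSite W F y) from h1, norm_Ad_of_unitary (btree_mem hWu M z y)]
  rw [hcov, covLapSite_eq_neg_flat_sub_transport W' G y]
  -- (i) the flat second differences of `tent²`
  have hflat : ‖∑ ν : Fin d, ((G (y + e ν) - G y) - (G y - G (y - e ν)))‖ ≤ (d : ℝ) * (3 / (M : ℝ) ^ 2 * ‖X‖) := by
    have h1 : ∀ ν : Fin d, ‖(G (y + e ν) - G y) - (G y - G (y - e ν))‖ ≤ 3 / (M : ℝ) ^ 2 * ‖X‖ := by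
      intro ν
      have hid : (G (y + e ν) - G y) - (G y - G (y - e ν)) = (tent M (y + e ν) ^ 2 - 2 * tent M y ^ 2 + tent M (y - e ν) ^ 2) • X := by
        rw [hGp ν, hGm ν, hGy]
        simp only [sub_smul, add_smul, mul_smul, two_smul]
        abel
      rw [hid, norm_smul, Real.norm_eq_abs]
      exact mul_le_mul_of_nonneg_right (abs_tentSq_sdiff_le hM1 (h ν).2 (h ν).1) (norm_nonneg _)
    calc _ ≤ ∑ ν : Fin d, ‖(G (y + e ν) - G y) - (G y - G (y - e ν))‖ := norm_sum_le _ _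
      _ ≤ ∑ _ν : Fin d, 3 / (M : ℝ) ^ 2 * ‖X‖ := Finset.sum_le_sum fun ν _ => h1 ν
      _ = (d : ℝ) * (3 / (M : ℝ) ^ 2 * ‖X‖) := by rw [Finset.sum_const, Finset.card_univ, Fintype.card_fin, nsmul_eq_mul]
  -- (ii) the comb gauge is a near-identity box on the bonds `(y, ν)`, `(y − e_ν, ν)`
  set a : ℝ := ((d : ℝ) - 1) * ((M : ℝ) - 1) * x with ha
  have hap : ∀ ν : Fin d, ‖((W' y ν : (Matrix n n ℂ)ˣ) : Matrix n n ℂ) - 1‖ ≤ a := by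
    intro ν
    refine comb_nearOne hWu hx hWx z y ν (fun i => ?_) (fun i => ?_)
    · simp only [Pi.smul_apply, smul_eq_mul]; rw [hyi i]; linarith [hρ0 i]
    · simp only [Pi.add_apply, Pi.smul_apply, smul_eq_mul, e_apply]
      rw [hyi i]
      split_ifs with hi
      · subst hi; linarith [hρhi i]
      · linarith [hρM i]
  have ham : ∀ ν : Fin d, ‖((W' (y - e ν) ν : (Matrix n n ℂ)ˣ) : Matrix n n ℂ) - 1‖ ≤ a := by
    intro ν
    refine comb_nearOne hWu hx hWx z (y - e ν) ν (fun i => ?_) (fun i => ?_)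
    · simp only [Pi.sub_apply, Pi.smul_apply, smul_eq_mul, e_apply]
      rw [hyi i]
      split_ifs with hi
      · subst hi; linarith [hρlo i]
      · linarith [hρ0 i]
    · rw [sub_add_cancel]
      simp only [Pi.add_apply, Pi.smul_apply, smul_eq_mul]
      rw [hyi i]; linarith [hρM i]
  -- (iii) the lattice divergence of the comb gauge at `y`
  set R : ℕ := M - 2 with hRdef
  have hRz : ((R : ℕ) : ℤ) = (M : ℤ) - 2 := by rw [hRdef]; omega
  have hRr : ((R : ℕ) : ℝ) = (M : ℝ) - 2 := by rw [hRdef, Nat.cast_sub hM]; norm_num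
  set y₀ : Site d := (M : ℤ) • z + fun _ => (R : ℤ) + 1 with hy₀
  have hbase : y₀ - (fun _ => (R : ℤ) + 1) = (M : ℤ) • z := by rw [hy₀]; exact add_sub_cancel_right _ _
  have hyR : ∀ i, |y i - y₀ i| ≤ (R : ℤ) := by
    intro i
    rw [hyi i, hy₀, Pi.add_apply, Pi.smul_apply, smul_eq_mul, hRz, abs_le]
    constructor <;> linarith [hρlo i, hρhi i]
  have hdiv : ‖∑ ν : Fin d, ((((W' y ν : (Matrix n n ℂ)ˣ) : Matrix n n ℂ) - 1) - (((W' (y - e ν) ν : (Matrix n n ℂ)ˣ) : Matrix n n ℂ) - 1))‖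
      ≤ 2 * (d : ℝ) ^ 2 * ((M : ℝ) - 1) * x₁ + 8 * (d : ℝ) ^ 3 * ((M : ℝ) - 1) ^ 2 * x ^ 2 := by
    have h1 := norm_axialDivergence_le hWu hx hx10 hWx hgrad y₀ R y hyR
    rw [hbase] at h1
    have hWeq : gaugeAct (axialFn W ((M : ℤ) • z)) W = W' := rfl
    rw [hWeq] at h1
    refine h1.trans (le_of_eq ?_)
    rw [hRr]; ring
  -- (iv) the transport pairs: commutator with the divergence plus `4a² + 8a∕M` per direction
  set Dν : Fin d → Matrix n n ℂ := fun ν => (((W' y ν : (Matrix n n ℂ)ˣ) : Matrix n n ℂ) - 1) - (((W' (y - e ν) ν : (Matrix n n ℂ)ˣ) : Matrix n n ℂ) - 1)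
    with hDν
  set Tν : Fin d → Matrix n n ℂ := fun ν => (Ad (W' y ν) (G (y + e ν)) - G (y + e ν)) + (Ad (W' (y - e ν) ν)⁻¹ (G (y - e ν)) - G (y - e ν))
    with hTν
  have hGyn : ‖G y‖ ≤ ‖X‖ := by
    rw [hGy, norm_smul, Real.norm_of_nonneg (sq_nonneg _)]
    have : tent M y ^ 2 ≤ 1 := pow_le_one₀ (tent_nonneg hM1 y) (tent_le_one hM1 y)
    exact (mul_le_mul_of_nonneg_right this (norm_nonneg _)).trans (by rw [one_mul])
  have hstep_p : ∀ ν : Fin d, ‖G (y + e ν) - G y‖ ≤ 2 / (M : ℝ) * ‖X‖ := by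
    intro ν
    rw [hGp ν, hGy, ← sub_smul, norm_smul, Real.norm_eq_abs]
    exact mul_le_mul_of_nonneg_right (abs_tentSq_step_le hM1 (h ν).2) (norm_nonneg _)
  have hstep_m : ∀ ν : Fin d, ‖G (y - e ν) - G y‖ ≤ 2 / (M : ℝ) * ‖X‖ := by
    intro ν
    rw [hGm ν, hGy, ← sub_smul, norm_smul, Real.norm_eq_abs, abs_sub_comm]
    have hres : res M (y - e ν) ν ≠ (M : ℤ) - 1 := by
      rw [(interior_coords hM1 h ν).2.2.2, Pi.sub_apply, e_apply, if_pos rfl]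
      have := hρM ν; simp only [hρ] at this ⊢; omega
    have h1 := abs_tentSq_step_le hM1 hres
    rw [sub_add_cancel] at h1
    exact mul_le_mul_of_nonneg_right h1 (norm_nonneg _)
  have hT : ∀ ν : Fin d, ‖Tν ν - (Dν ν * G y - G y * Dν ν)‖ ≤ (4 * a ^ 2 + 8 * a / M) * ‖X‖ := by
    intro ν
    have ha0 : 0 ≤ a := (norm_nonneg _).trans (hap ν)
    have h1 := norm_transport_pair_sub_comm_le (hW'u y ν) (hW'u (y - e ν) ν) (hap ν) (ham ν) (G y) (G (y + e ν)) (G (y - e ν))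
    refine h1.trans ?_
    have e1 : 4 * a ^ 2 * ‖G y‖ ≤ 4 * a ^ 2 * ‖X‖ := by gcongr
    have e2 : 2 * a * ‖G (y + e ν) - G y‖ ≤ 2 * a * (2 / (M : ℝ) * ‖X‖) := by gcongr; exact hstep_p ν
    have e3 : 2 * a * ‖G (y - e ν) - G y‖ ≤ 2 * a * (2 / (M : ℝ) * ‖X‖) := by gcongr; exact hstep_m ν
    have e4 : 4 * a ^ 2 * ‖X‖ + 2 * a * (2 / (M : ℝ) * ‖X‖) + 2 * a * (2 / (M : ℝ) * ‖X‖) = (4 * a ^ 2 + 8 * a / M) * ‖X‖ := by ring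
    linarith
  have hcomm : ‖∑ ν : Fin d, (Dν ν * G y - G y * Dν ν)‖ ≤ 2 * (2 * (d : ℝ) ^ 2 * ((M : ℝ) - 1) * x₁ + 8 * (d : ℝ) ^ 3 * ((M : ℝ) - 1) ^ 2 * x ^ 2) * ‖X‖ := by
    have hsum : ∑ ν : Fin d, (Dν ν * G y - G y * Dν ν) = (∑ ν : Fin d, Dν ν) * G y - G y * ∑ ν : Fin d, Dν ν := by
      rw [Finset.sum_sub_distrib, Finset.sum_mul, Finset.mul_sum]
    rw [hsum]
    refine (norm_comm_le _ _).trans ?_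
    have hδ0 : 0 ≤ 2 * (d : ℝ) ^ 2 * ((M : ℝ) - 1) * x₁ + 8 * (d : ℝ) ^ 3 * ((M : ℝ) - 1) ^ 2 * x ^ 2 := (norm_nonneg _).trans hdiv
    exact mul_le_mul (mul_le_mul_of_nonneg_left hdiv (by norm_num)) hGyn (norm_nonneg _) (by positivity)
  have htrans : ‖∑ ν : Fin d, Tν ν‖ ≤ 2 * (2 * (d : ℝ) ^ 2 * ((M : ℝ) - 1) * x₁ + 8 * (d : ℝ) ^ 3 * ((M : ℝ) - 1) ^ 2 * x ^ 2) * ‖X‖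
      + (d : ℝ) * ((4 * a ^ 2 + 8 * a / M) * ‖X‖) := by
    have hsplit : ∑ ν : Fin d, Tν ν = ∑ ν : Fin d, (Dν ν * G y - G y * Dν ν) + ∑ ν : Fin d, (Tν ν - (Dν ν * G y - G y * Dν ν)) := by
      rw [← Finset.sum_add_distrib]
      exact Finset.sum_congr rfl fun ν _ => by abel
    rw [hsplit]
    refine (norm_add_le _ _).trans (add_le_add hcomm ?_)
    calc ‖∑ ν : Fin d, (Tν ν - (Dν ν * G y - G y * Dν ν))‖ ≤ ∑ ν : Fin d, ‖Tν ν - (Dν ν * G y - G y * Dν ν)‖ := norm_sum_le _ _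
      _ ≤ ∑ _ν : Fin d, (4 * a ^ 2 + 8 * a / M) * ‖X‖ := Finset.sum_le_sum fun ν _ => hT ν
      _ = (d : ℝ) * ((4 * a ^ 2 + 8 * a / M) * ‖X‖) := by rw [Finset.sum_const, Finset.card_univ, Fintype.card_fin, nsmul_eq_mul]
  -- assemble
  calc ‖-(∑ ν : Fin d, ((G (y + e ν) - G y) - (G y - G (y - e ν)))) - ∑ ν : Fin d, Tν ν‖
      ≤ ‖-(∑ ν : Fin d, ((G (y + e ν) - G y) - (G y - G (y - e ν))))‖ + ‖∑ ν : Fin d, Tν ν‖ := norm_sub_le _ _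
    _ ≤ (d : ℝ) * (3 / (M : ℝ) ^ 2 * ‖X‖) + (2 * (2 * (d : ℝ) ^ 2 * ((M : ℝ) - 1) * x₁ + 8 * (d : ℝ) ^ 3 * ((M : ℝ) - 1) ^ 2 * x ^ 2) * ‖X‖
      + (d : ℝ) * ((4 * a ^ 2 + 8 * a / M) * ‖X‖)) := by rw [norm_neg]; exact add_le_add hflat htrans
    _ = _ := by rw [ha]; ring

/-! ## §4 Every site -/

/-- **THE COVARIANT LAPLACIAN OF A DRESSED SQUARED-TENT BUMP IS `O(1∕M²)` TIMES THE COEFFICIENT SUP** (`M ≥ 2`, `W` unitary with `SmallField W x`, covariant plaquette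
gradients `≤ x₁`, `‖c‖_∞ ≤ C`): for EVERY site `y`,
`‖Δ_W (dressW M W (bump2 M c)) y‖ ≤ (35d∕M² + 2(2d²(M−1)x₁ + 8d³(M−1)²x²) + 4d((d−1)(M−1)x)² + 8d(d−1)(M−1)x∕M)·C`. [folklore] -/
theorem norm_covLapSite_dressW_bump2_le [Nonempty n] (hd : 1 ≤ d) {M : ℕ} (hM : 2 ≤ M) {W : Site d → Fin d → (Matrix n n ℂ)ˣ} (hWu : IsUnitaryCfg W)
    {x x₁ : ℝ} (hx : 0 ≤ x) (hx10 : 0 ≤ x₁) (hWx : SmallField W x)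
    (hgrad : ∀ (p : Site d) (μ κ : Fin d), κ ≠ μ →
      ‖Ad (W p μ) ((hol W (p + e μ) (plaqWord κ μ) : (Matrix n n ℂ)ˣ) : Matrix n n ℂ) - ((hol W p (plaqWord κ μ) : (Matrix n n ℂ)ˣ) : Matrix n n ℂ)‖ ≤ x₁)
    (c : Site d → Matrix n n ℂ) {C : ℝ} (hc : ∀ z, ‖c z‖ ≤ C) (y : Site d) :
    ‖covLapSite W (dressW M W (bump2 M c)) y‖
      ≤ (35 * (d : ℝ) / (M : ℝ) ^ 2 + 2 * (2 * (d : ℝ) ^ 2 * ((M : ℝ) - 1) * x₁ + 8 * (d : ℝ) ^ 3 * ((M : ℝ) - 1) ^ 2 * x ^ 2)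
          + 4 * (d : ℝ) * (((d : ℝ) - 1) * ((M : ℝ) - 1) * x) ^ 2 + 8 * (d : ℝ) * (((d : ℝ) - 1) * ((M : ℝ) - 1) * x) / M) * C := by
  have hM1 : 1 ≤ M := by omega
  have hM0 : (0 : ℝ) < M := by exact_mod_cast (by omega : 0 < M)
  have hM1r : (1 : ℝ) ≤ M := by exact_mod_cast hM1
  have hC0 : 0 ≤ C := (norm_nonneg _).trans (hc 0)
  have hd1 : (1 : ℝ) ≤ d := by exact_mod_cast hd
  have hMm1 : (0 : ℝ) ≤ (M : ℝ) - 1 := by linarith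
  have hdm1 : (0 : ℝ) ≤ (d : ℝ) - 1 := by linarith
  have ha0 : 0 ≤ ((d : ℝ) - 1) * ((M : ℝ) - 1) * x := mul_nonneg (mul_nonneg hdm1 hMm1) hx
  have hδ0 : 0 ≤ 2 * (2 * (d : ℝ) ^ 2 * ((M : ℝ) - 1) * x₁ + 8 * (d : ℝ) ^ 3 * ((M : ℝ) - 1) ^ 2 * x ^ 2) := by positivity
  have hsq0 : 0 ≤ 4 * (d : ℝ) * (((d : ℝ) - 1) * ((M : ℝ) - 1) * x) ^ 2 := by positivity
  have hlin0 : 0 ≤ 8 * (d : ℝ) * (((d : ℝ) - 1) * ((M : ℝ) - 1) * x) / M := by positivity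
  have h3 : 0 ≤ 3 * (d : ℝ) / (M : ℝ) ^ 2 := by positivity
  have h32 : 0 ≤ 32 * (d : ℝ) / (M : ℝ) ^ 2 := by positivity
  have hsplit : 35 * (d : ℝ) / (M : ℝ) ^ 2 = 3 * (d : ℝ) / (M : ℝ) ^ 2 + 32 * (d : ℝ) / (M : ℝ) ^ 2 := by ring
  by_cases hint : ∀ i, res M y i ≠ 0 ∧ res M y i ≠ (M : ℤ) - 1
  · -- interior site: §3
    have h1 := norm_covLapSite_dressW_bump2_interior_le hM hWu hx hx10 hWx hgrad c hint
    have hK0 : 0 ≤ 3 * (d : ℝ) / (M : ℝ) ^ 2 + 2 * (2 * (d : ℝ) ^ 2 * ((M : ℝ) - 1) * x₁ + 8 * (d : ℝ) ^ 3 * ((M : ℝ) - 1) ^ 2 * x ^ 2)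
        + 4 * (d : ℝ) * (((d : ℝ) - 1) * ((M : ℝ) - 1) * x) ^ 2 + 8 * (d : ℝ) * (((d : ℝ) - 1) * ((M : ℝ) - 1) * x) / M := by positivity
    refine h1.trans ((mul_le_mul_of_nonneg_left (hc _) hK0).trans (mul_le_mul_of_nonneg_right ?_ hC0))
    rw [hsplit]; linarith
  · -- near-face site: §2
    push Not at hint
    obtain ⟨i, hi⟩ := hint
    have hface : res M y i = 0 ∨ res M y i = (M : ℤ) - 1 := (em (res M y i = 0)).imp_right hi
    have h1 := norm_covLapSite_dressW_bump2_nearFace_le hM hWu c hc hface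
    refine h1.trans (mul_le_mul_of_nonneg_right ?_ hC0)
    rw [hsplit]; linarith

end

end Summit.QuantumFields.BalabanUV.T4Continuum.NE7SquaredBumpCovariantLaplacian
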